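/-
Copyright (c) 2026 the pub-hodgecm-mathlib formalisation cell (harness21).  Prover seat hodgecm-mathlib-F0P2-p06 (g13): road «S3-ram» (LEAD F0P3a-plan (g12); architect
A-p16 (g31); junction pen F0P3a-p01 (g17), J-PACK v2 skeleton v5: the κ-KEYED slice sockets; owner F0P3a-p06 (g15)); 2026-09-02.
-/
import Literature.NumberTheory.Automorphic.UnitaryLatticeTreeRootSliceCountRamified    -- ★ p847590 (this seat): ROW-ROOT-SLICE (brings ★ J6-mult p847357, G3⁺, G3, G1, transitivity)
import Literature.NumberTheory.Automorphic.UnitaryLatticeTreeFixedGrandchildFrameRamified  -- ★ L p847469 (F0P2-p01): `latticeGraphIso_root_eq_of_mem_unitaryInt`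
import HarnessLib

/-!
# The lattice graph of a hermitian space — THE κ-KEYED SLICE COUNTS (J-PACK v2 skeleton v5 sockets `row_rootSlice`, `row_offRegionSlice`): a vertex predicate decided on
# each slice by a predicate of the child's FRAME is counted by `#{w ∈ GC(v) : P w} = q · #{children (uκ)·N₁ : Pκ κ}` (Kottwitz 1986 §3; Serre, *Trees*; Bruhat–Tits 1972 §10)

Topic `NumberTheory/Automorphic`; namespace `Literature.NumberTheory.Automorphic.UnitaryLatticeTree`.  THEOREMS ONLY (no definition, no instance, no notation, no named fact,
no `sorry`); kernel lane `--supports stmt-HodgeConjecture-24833`.  Cell `pub/hodgecm-mathlib` (D-0151), crux H413; road «S3-ram» (Literature seeding, count-neutral);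
J-PACK v2 skeleton v5 (junction pen F0P3a-p01 (g17) 01:38:15Z): the two SLICE sockets RE-CUT to the κ-keyed shape the assembly consumes — the vertex predicate `P` is decided on
the slice through the child `(uκ)·N₁` by a frame predicate `Pκ κ` (hypothesis `hPκ`, stated for SELF-DUAL, FIXED far vertices `w ≠ v`), and the right-hand side counts
`{c | v ~ c ∧ … ∧ ∃ κ ∈ K₀, c = (uκ)·N₁ ∧ Pκ κ}` (the shape of ★ ROOT-CNT's `hνE`).  THIS FILE: §1 far vertices through a child are self-dual (★ star of `N₁`) — with ★ G3⁺ «every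
child passes two levels deep» they are fixed, so `hPκ` applies to EVERY far vertex; §2 ONE generic count at any `v = u·r₀` with the level-two token (root and non-root alike:
★ ROW-ROOT-SLICE ∕ ★ J6-mult), where «`P` along the slice of `c`» ⟺ `Pκ κ` for ANY frame `κ` of `c` because a slice carries `q ≥ 1` fixed far vertices
(★ `ncard_fixed_children_latticeGraphIso_of_congr_sq`); §3 the two socket texts verbatim (`row_rootSlice` v2: `u = 1`, `hdeep`; `row_offRegionSlice` v2: region vertex
`v = u·r₀`, `LEV[v](ϖ^{d₀})`, `d₀ ≥ 3` — the isoceles eigen-data are carried but not used).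

HONEST LABEL: HC_CM is proved only modulo the 2 remaining named inputs (hLiu418 24832, h413 24833) until rung 0 closes; nothing printed is asserted here (rooted-tree
bookkeeping over ★ results); «S3-ram» has no books consequence.

## References
* [Kottwitz1986] R. E. Kottwitz, *Base change for unit elements of Hecke algebras*, Compositio Math. 60 (1986), §3 (counting fixed lattices shell by shell).
* [Serre1980Trees] J.-P. Serre, *Trees* (1980), Ch. I §2.3 (rooted trees), Ch. II §1.1 (neighbours of a lattice; fixed subtrees).
* [BruhatTits1972] F. Bruhat, J. Tits, *Groupes réductifs sur un corps local I*, Publ. Math. IHÉS 41 (1972), §10.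
* [Tits1979] J. Tits, *Reductive groups over local fields*, PSPM 33.1 (1979), §2.4, §3.5.
-/

set_option autoImplicit false

noncomputable section

open scoped Valued WithZero Matrix MatrixGroups

namespace Literature.NumberTheory.Automorphic.UnitaryLatticeTree

open Literature.NumberTheory.Automorphic Literature.NumberTheory.Automorphic.HermitianLattice
open Literature.NumberTheory.Automorphic.CartanUnique
open Literature.Combinatorics.SimpleGraph.TreeLayers

variable {K : Type*} [Field K] [Valued K ℤᵐ⁰] {σ : K →+* K} {ϖ : K}

/-! ## §1 Far vertices through a child are self-dual -/

/-- **The far vertices through a child are SELF-DUAL**: every neighbour of the type-two vertex `u·N₁` is a self-dual vertex (pull back along `u`; ★ star of `N₁`: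
`N₁ < w` forces type `0`). [cite: BruhatTits1972, §10] [cite: Serre1980Trees, II.1.1] [cite: Tits1979, §2.4] -/
theorem isSelfDualLattice_of_adj_latticeGraphIso_N₁ (hvσ : ∀ a, Valued.v (σ a) = Valued.v a) (hσϖ : σ ϖ = -ϖ) (hϖ : Valued.v ϖ = WithZero.exp (-1 : ℤ))
    (u : unitaryGroupOfForm σ ((StdForm.antidiagonal 3).over K)) {w : {M : Submodule 𝒪[K] (Fin 3 → K) // IsVertex σ ϖ ((StdForm.antidiagonal 3).over K) M}} (hcw : (latticeGraph σ ϖ ((StdForm.antidiagonal 3).over K)).Adj (latticeGraphIso σ ϖ ((StdForm.antidiagonal 3).over K) u ⟨latt (Matrix.diagonal ![(1 : K), 1, ϖ]), 2, isVertexLattice_two_N₁_of_neg hσϖ hϖ⟩) w) : IsSelfDualLattice σ ϖ ((StdForm.antidiagonal 3).over K) w.1 := by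
  set w' := latticeGraphIso σ ϖ ((StdForm.antidiagonal 3).over K) u⁻¹ w with hw'def
  have hww' : latticeGraphIso σ ϖ ((StdForm.antidiagonal 3).over K) u w' = w := latticeGraphIso_mul_inv_apply _ _
  have hw' : w' ∈ (latticeGraph σ ϖ ((StdForm.antidiagonal 3).over K)).neighborSet ⟨latt (Matrix.diagonal ![(1 : K), 1, ϖ]), 2, isVertexLattice_two_N₁_of_neg hσϖ hϖ⟩ := by
    rw [SimpleGraph.mem_neighborSet, ← (latticeGraphIso σ ϖ ((StdForm.antidiagonal 3).over K) u).map_adj_iff, hww']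
    exact hcw
  have hlt := (mem_neighborSet_N₁_iff_of_v hvσ hϖ (isVertexLattice_two_N₁_of_neg hσϖ hϖ) w').1 hw'
  have hsd' : IsSelfDualLattice σ ϖ ((StdForm.antidiagonal 3).over K) w'.1 :=
    (isVertexLattice_two_and_isSelfDualLattice_of_lt_of_v hvσ hϖ ⟨2, isVertexLattice_two_N₁_of_neg hσϖ hϖ⟩ w'.2 hlt).2
  rw [← hww', latticeGraphIso_apply_val]
  exact isVertexLattice_mapGL σ ϖ _ _ u.2 hsd'

/-! ## §2 The κ-keyed slice count at any `v = u·r₀` two levels deep -/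

section Three

/-- **THE κ-KEYED SLICE COUNT** at `v = u·r₀` (root or not), `γ·v = v`, `(γ−1)·v ⊆ ϖ²·v`: if `P w ⟺ Pκ κ` for every self-dual fixed far vertex `w ≠ v` through the child
`(uκ)·N₁` (`κ ∈ K₀`), then `#{w ∈ GC(v) : P w} = q · #{c child of v : ∃ κ ∈ K₀, c = (uκ)·N₁ ∧ Pκ κ}` — every child passes (★ G3⁺), every far vertex is self-dual (§1) and a
child of `c` in the rooted tree (★ G1), each slice has `q ≥ 1` such vertices so «`P` on the slice» ⟺ `Pκ κ` for ANY frame; then ★ ROW-ROOT-SLICE (`v = r₀`) ∕ ★ J6-mult (`v ≠ r₀`).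
[cite: Kottwitz1986, §3] [cite: Serre1980Trees, I.2.3, II.1.1] [cite: BruhatTits1972, §10] [cite: Tits1979, §3.5] -/
theorem ncard_fixedGrandchildren_sep_eq_mul_ncard_keyed (hσ : ∀ x, σ (σ x) = x) (hvσ : ∀ a, Valued.v (σ a) = Valued.v a) (hσϖ : σ ϖ = -ϖ)
    (hϖ : Valued.v ϖ = WithZero.exp (-1 : ℤ)) (hres : ∀ x : K, Valued.v x ≤ 1 → Valued.v (σ x - x) < 1) (h2 : Valued.v (2 : K) = 1) [Finite 𝓀[K]]
    (hT : (latticeGraph σ ϖ ((StdForm.antidiagonal 3).over K)).IsTree)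
    {γ : unitaryGroupOfForm σ ((StdForm.antidiagonal 3).over K)} (u : unitaryGroupOfForm σ ((StdForm.antidiagonal 3).over K)) (hfix : latticeGraphIso σ ϖ ((StdForm.antidiagonal 3).over K) γ (latticeGraphIso σ ϖ ((StdForm.antidiagonal 3).over K) u ⟨stdLattice K 3, 0, isSelfDualLattice_stdLattice_three_of_v hϖ⟩) = (latticeGraphIso σ ϖ ((StdForm.antidiagonal 3).over K) u ⟨stdLattice K 3, 0, isSelfDualLattice_stdLattice_three_of_v hϖ⟩))
    (hlev2 : (latticeGraphIso σ ϖ ((StdForm.antidiagonal 3).over K) u ⟨stdLattice K 3, 0, isSelfDualLattice_stdLattice_three_of_v hϖ⟩).1.map ((Matrix.toLin' (((γ : GL (Fin 3) K) : Matrix (Fin 3) (Fin 3) K) - 1)).restrictScalars 𝒪[K]) ≤ scaleLattice (ϖ ^ 2) (latticeGraphIso σ ϖ ((StdForm.antidiagonal 3).over K) u ⟨stdLattice K 3, 0, isSelfDualLattice_stdLattice_three_of_v hϖ⟩).1)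
    (Pκ : unitaryGroupOfForm σ ((StdForm.antidiagonal 3).over K) → Prop) (P : {M : Submodule 𝒪[K] (Fin 3 → K) // IsVertex σ ϖ ((StdForm.antidiagonal 3).over K) M} → Prop)
    (hPκ : ∀ κ : unitaryGroupOfForm σ ((StdForm.antidiagonal 3).over K), κ ∈ unitaryInt σ ((StdForm.antidiagonal 3).over K) → ∀ w : {M : Submodule 𝒪[K] (Fin 3 → K) // IsVertex σ ϖ ((StdForm.antidiagonal 3).over K) M}, IsSelfDualLattice σ ϖ ((StdForm.antidiagonal 3).over K) w.1 → latticeGraphIso σ ϖ ((StdForm.antidiagonal 3).over K) γ w = w → w ≠ (latticeGraphIso σ ϖ ((StdForm.antidiagonal 3).over K) u ⟨stdLattice K 3, 0, isSelfDualLattice_stdLattice_three_of_v hϖ⟩) →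
      (latticeGraph σ ϖ ((StdForm.antidiagonal 3).over K)).Adj (latticeGraphIso σ ϖ ((StdForm.antidiagonal 3).over K) (u * κ) ⟨latt (Matrix.diagonal ![(1 : K), 1, ϖ]), 2, isVertexLattice_two_N₁_of_neg hσϖ hϖ⟩) w → (P w ↔ Pκ κ)) :
    ({w | w ∈ {w | ∃ c, ((latticeGraph σ ϖ ((StdForm.antidiagonal 3).over K)).Adj (latticeGraphIso σ ϖ ((StdForm.antidiagonal 3).over K) u ⟨stdLattice K 3, 0, isSelfDualLattice_stdLattice_three_of_v hϖ⟩) c ∧ (latticeGraph σ ϖ ((StdForm.antidiagonal 3).over K)).dist ⟨stdLattice K 3, 0, isSelfDualLattice_stdLattice_three_of_v hϖ⟩ c = (latticeGraph σ ϖ ((StdForm.antidiagonal 3).over K)).dist ⟨stdLattice K 3, 0, isSelfDualLattice_stdLattice_three_of_v hϖ⟩ (latticeGraphIso σ ϖ ((StdForm.antidiagonal 3).over K) u ⟨stdLattice K 3, 0, isSelfDualLattice_stdLattice_three_of_v hϖ⟩) + 1 ∧ latticeGraphIso σ ϖ ((StdForm.antidiagonal 3).over K) γ c = c) ∧ ((latticeGraph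 σ ϖ ((StdForm.antidiagonal 3).over K)).Adj c w ∧ (latticeGraph σ ϖ ((StdForm.antidiagonal 3).over K)).dist ⟨stdLattice K 3, 0, isSelfDualLattice_stdLattice_three_of_v hϖ⟩ w = (latticeGraph σ ϖ ((StdForm.antidiagonal 3).over K)).dist ⟨stdLattice K 3, 0, isSelfDualLattice_stdLattice_three_of_v hϖ⟩ c + 1 ∧ latticeGraphIso σ ϖ ((StdForm.antidiagonal 3).over K) γ w = w)} ∧ (P w)}).ncard =
      Nat.card 𝓀[K] * {c : {M : Submodule 𝒪[K] (Fin 3 → K) // IsVertex σ ϖ ((StdForm.antidiagonal 3).over K) M} | (latticeGraph σ ϖ ((StdForm.antidiagonal 3).over K)).Adj (latticeGraphIso σ ϖ ((StdForm.antidiagonal 3).over K) u ⟨stdLattice K 3, 0, isSelfDualLattice_stdLattice_three_of_v hϖ⟩) c ∧ (latticeGraph σ ϖ ((StdForm.antidiagonal 3).over K)).dist ⟨stdLattice K 3, 0, isSelfDualLattice_stdLattice_three_of_v hϖ⟩ c = (latticeGraph σ ϖ ((StdForm.antidiagonal 3).over K)).dist ⟨stdLattice K 3, 0, isSelfDualLattice_stdLattice_three_of_v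 hϖ⟩ (latticeGraphIso σ ϖ ((StdForm.antidiagonal 3).over K) u ⟨stdLattice K 3, 0, isSelfDualLattice_stdLattice_three_of_v hϖ⟩) + 1 ∧ ∃ κ : unitaryGroupOfForm σ ((StdForm.antidiagonal 3).over K), κ ∈ unitaryInt σ ((StdForm.antidiagonal 3).over K) ∧
        c = latticeGraphIso σ ϖ ((StdForm.antidiagonal 3).over K) (u * κ) ⟨latt (Matrix.diagonal ![(1 : K), 1, ϖ]), 2, isVertexLattice_two_N₁_of_neg hσϖ hϖ⟩ ∧ Pκ κ}.ncard := by
  classical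
  have hϖ0 : ϖ ≠ 0 := fun h0 => by rw [h0, map_zero] at hϖ; exact WithZero.coe_ne_zero hϖ.symm
  have hϖ1 : Valued.v ϖ < 1 := by rw [hϖ, ← WithZero.exp_zero]; exact WithZero.exp_lt_exp.2 (by norm_num)
  -- the rooted parent map
  obtain ⟨p, hpar, hchild, hproot, -⟩ := exists_rooted_parent hT (⟨stdLattice K 3, 0, isSelfDualLattice_stdLattice_three_of_v hϖ⟩ : {M : Submodule 𝒪[K] (Fin 3 → K) // IsVertex σ ϖ ((StdForm.antidiagonal 3).over K) M})
  -- `γ′ = u⁻¹γu ∈ K₀`, `≡ 1 (mod ϖ²)`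
  have hγK : u⁻¹ * γ * u ∈ unitaryInt σ ((StdForm.antidiagonal 3).over K) := mem_unitaryInt_conj_of_latticeGraphIso_apply_root_eq hfix
  have hγϖ2 : ∀ i j, Valued.v ((((((u)⁻¹ * γ * (u) : unitaryGroupOfForm σ ((StdForm.antidiagonal 3).over K)) : GL (Fin 3) K) : Matrix (Fin 3) (Fin 3) K) - 1) i j) ≤ Valued.v ϖ ^ 2 := by
    have h := (forall_v_conj_sub_one_le_iff_map_sub_one_le_scaleLattice γ u (pow_ne_zero 2 hϖ0)).1 hlev2
    intro i j; rw [← map_pow]; exact h i j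
  -- every far vertex through a child `(uκ)·N₁` is fixed (★ G3⁺) and self-dual (§1)
  have hfar : ∀ κ : unitaryGroupOfForm σ ((StdForm.antidiagonal 3).over K), κ ∈ unitaryInt σ ((StdForm.antidiagonal 3).over K) → ∀ w : {M : Submodule 𝒪[K] (Fin 3 → K) // IsVertex σ ϖ ((StdForm.antidiagonal 3).over K) M}, (latticeGraph σ ϖ ((StdForm.antidiagonal 3).over K)).Adj (latticeGraphIso σ ϖ ((StdForm.antidiagonal 3).over K) (u * κ) ⟨latt (Matrix.diagonal ![(1 : K), 1, ϖ]), 2, isVertexLattice_two_N₁_of_neg hσϖ hϖ⟩) w →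
      latticeGraphIso σ ϖ ((StdForm.antidiagonal 3).over K) γ w = w ∧ IsSelfDualLattice σ ϖ ((StdForm.antidiagonal 3).over K) w.1 := fun κ hκ w hw =>
    ⟨forall_fixed_neighbor_of_congr_sq hvσ hσϖ hϖ hres hγK hκ hγϖ2 ((SimpleGraph.mem_neighborSet _ _ _).2 hw),
      isSelfDualLattice_of_adj_latticeGraphIso_N₁ hvσ hσϖ hϖ (u * κ) hw⟩
  -- the children of `v` are framed
  have hnb : ∀ c, (latticeGraph σ ϖ ((StdForm.antidiagonal 3).over K)).Adj (latticeGraphIso σ ϖ ((StdForm.antidiagonal 3).over K) u ⟨stdLattice K 3, 0, isSelfDualLattice_stdLattice_three_of_v hϖ⟩) c → ∃ κ : unitaryGroupOfForm σ ((StdForm.antidiagonal 3).over K), κ ∈ unitaryInt σ ((StdForm.antidiagonal 3).over K) ∧ c = latticeGraphIso σ ϖ ((StdForm.antidiagonal 3).over K) (u * κ) ⟨latt (Matrix.diagonal ![(1 : K), 1, ϖ]), 2, isVertexLattice_two_N₁_of_neg hσϖ hϖ⟩ := fun c hc =>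
    (mem_neighborSet_latticeGraphIso_root_iff hσ hvσ hσϖ hϖ h2 u c).1 ((SimpleGraph.mem_neighborSet _ _ _).2 hc)
  -- in the rooted tree every neighbour `w ≠ v` of a child `c` of `v` is a child of `c`
  have hcdist : ∀ c w, (latticeGraph σ ϖ ((StdForm.antidiagonal 3).over K)).Adj (latticeGraphIso σ ϖ ((StdForm.antidiagonal 3).over K) u ⟨stdLattice K 3, 0, isSelfDualLattice_stdLattice_three_of_v hϖ⟩) c → (latticeGraph σ ϖ ((StdForm.antidiagonal 3).over K)).dist ⟨stdLattice K 3, 0, isSelfDualLattice_stdLattice_three_of_v hϖ⟩ c = (latticeGraph σ ϖ ((StdForm.antidiagonal 3).over K)).dist ⟨stdLattice K 3, 0, isSelfDualLattice_stdLattice_three_of_v hϖ⟩ (latticeGraphIso σ ϖ ((StdForm.antidiagonal 3).over K) u ⟨stdLattice K 3, 0, isSelfDualLattice_stdLattice_three_of_v hϖ⟩) + 1 → (latticeGraph σ ϖ ((StdForm.antidiagonal 3).over K)).Adj c w → w ≠ (latticeGraphIso σ ϖ ((StdForm.antidiagonal 3).over K) u ⟨stdLattice K 3, 0, isSelfDualLattice_stdLattice_three_of_v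 hϖ⟩) →
      (latticeGraph σ ϖ ((StdForm.antidiagonal 3).over K)).dist ⟨stdLattice K 3, 0, isSelfDualLattice_stdLattice_three_of_v hϖ⟩ w = (latticeGraph σ ϖ ((StdForm.antidiagonal 3).over K)).dist ⟨stdLattice K 3, 0, isSelfDualLattice_stdLattice_three_of_v hϖ⟩ c + 1 := by
    intro c w hvc hdc hcw hne
    have hcr : c ≠ ⟨stdLattice K 3, 0, isSelfDualLattice_stdLattice_three_of_v hϖ⟩ := by intro h; rw [h, SimpleGraph.dist_self] at hdc; omega
    have hpc : p c = (latticeGraphIso σ ϖ ((StdForm.antidiagonal 3).over K) u ⟨stdLattice K 3, 0, isSelfDualLattice_stdLattice_three_of_v hϖ⟩) := by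
      rcases eq_or_ne (latticeGraphIso σ ϖ ((StdForm.antidiagonal 3).over K) u ⟨stdLattice K 3, 0, isSelfDualLattice_stdLattice_three_of_v hϖ⟩) ⟨stdLattice K 3, 0, isSelfDualLattice_stdLattice_three_of_v hϖ⟩ with h0 | h0
      · rw [h0] at hvc ⊢; exact hproot c hvc
      · refine (hchild _ c h0 hvc ?_).2
        intro hcp
        have h := (hpar _ h0).2
        rw [← hcp] at h
        omega
    have hwp : w ≠ p c := by rw [hpc]; exact hne
    exact (hchild c w hcr hcw hwp).1
  -- «`P` on the slice of `c`» ⟺ `Pκ κ`, for ANY frame `κ` of `c`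
  have hkey : ∀ c, (latticeGraph σ ϖ ((StdForm.antidiagonal 3).over K)).Adj (latticeGraphIso σ ϖ ((StdForm.antidiagonal 3).over K) u ⟨stdLattice K 3, 0, isSelfDualLattice_stdLattice_three_of_v hϖ⟩) c → (latticeGraph σ ϖ ((StdForm.antidiagonal 3).over K)).dist ⟨stdLattice K 3, 0, isSelfDualLattice_stdLattice_three_of_v hϖ⟩ c = (latticeGraph σ ϖ ((StdForm.antidiagonal 3).over K)).dist ⟨stdLattice K 3, 0, isSelfDualLattice_stdLattice_three_of_v hϖ⟩ (latticeGraphIso σ ϖ ((StdForm.antidiagonal 3).over K) u ⟨stdLattice K 3, 0, isSelfDualLattice_stdLattice_three_of_v hϖ⟩) + 1 → ∀ κ : unitaryGroupOfForm σ ((StdForm.antidiagonal 3).over K), κ ∈ unitaryInt σ ((StdForm.antidiagonal 3).over K) → c = latticeGraphIso σ ϖ ((StdForm.antidiagonal 3).over K) (u * κ) ⟨latt (Matrix.diagonal ![(1 : K), 1, ϖ]), 2, isVertexLattice_two_N₁_of_neg hσϖ hϖ⟩ →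
      ((∀ w, (latticeGraph σ ϖ ((StdForm.antidiagonal 3).over K)).Adj c w → (latticeGraph σ ϖ ((StdForm.antidiagonal 3).over K)).dist ⟨stdLattice K 3, 0, isSelfDualLattice_stdLattice_three_of_v hϖ⟩ w = (latticeGraph σ ϖ ((StdForm.antidiagonal 3).over K)).dist ⟨stdLattice K 3, 0, isSelfDualLattice_stdLattice_three_of_v hϖ⟩ c + 1 → P w) ↔ Pκ κ) := by
    intro c hvc hdc κ hκ hcκ
    obtain ⟨w₀, hw₀, hne₀, -⟩ := Set.nonempty_of_ncard_ne_zero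
      (by rw [ncard_fixed_children_latticeGraphIso_of_congr_sq hvσ hσϖ hϖ hres hγK hκ hγϖ2]; exact (Nat.card_pos (α := 𝓀[K])).ne')
    rw [SimpleGraph.mem_neighborSet] at hw₀
    have hne₀' : w₀ ≠ (latticeGraphIso σ ϖ ((StdForm.antidiagonal 3).over K) u ⟨stdLattice K 3, 0, isSelfDualLattice_stdLattice_three_of_v hϖ⟩) := fun h => hne₀ (by rw [h, latticeGraphIso_apply_val])
    have hcw₀ : (latticeGraph σ ϖ ((StdForm.antidiagonal 3).over K)).Adj c w₀ := by rw [hcκ]; exact hw₀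
    constructor
    · intro hall
      exact (hPκ κ hκ w₀ (hfar κ hκ w₀ hw₀).2 (hfar κ hκ w₀ hw₀).1 hne₀' hw₀).1 (hall w₀ hcw₀ (hcdist c w₀ hvc hdc hcw₀ hne₀'))
    · intro hPk w hcw hdw
      have hne : w ≠ (latticeGraphIso σ ϖ ((StdForm.antidiagonal 3).over K) u ⟨stdLattice K 3, 0, isSelfDualLattice_stdLattice_three_of_v hϖ⟩) := by intro h; rw [h] at hdw; omega
      have hw : (latticeGraph σ ϖ ((StdForm.antidiagonal 3).over K)).Adj (latticeGraphIso σ ϖ ((StdForm.antidiagonal 3).over K) (u * κ) ⟨latt (Matrix.diagonal ![(1 : K), 1, ϖ]), 2, isVertexLattice_two_N₁_of_neg hσϖ hϖ⟩) w := by rw [← hcκ]; exact hcw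
      exact (hPκ κ hκ w (hfar κ hκ w hw).2 (hfar κ hκ w hw).1 hne hw).2 hPk
  -- `P` is slice-constant
  have hP : ∀ c, (latticeGraph σ ϖ ((StdForm.antidiagonal 3).over K)).Adj (latticeGraphIso σ ϖ ((StdForm.antidiagonal 3).over K) u ⟨stdLattice K 3, 0, isSelfDualLattice_stdLattice_three_of_v hϖ⟩) c → (latticeGraph σ ϖ ((StdForm.antidiagonal 3).over K)).dist ⟨stdLattice K 3, 0, isSelfDualLattice_stdLattice_three_of_v hϖ⟩ c = (latticeGraph σ ϖ ((StdForm.antidiagonal 3).over K)).dist ⟨stdLattice K 3, 0, isSelfDualLattice_stdLattice_three_of_v hϖ⟩ (latticeGraphIso σ ϖ ((StdForm.antidiagonal 3).over K) u ⟨stdLattice K 3, 0, isSelfDualLattice_stdLattice_three_of_v hϖ⟩) + 1 →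
      ∀ w w', (latticeGraph σ ϖ ((StdForm.antidiagonal 3).over K)).Adj c w → (latticeGraph σ ϖ ((StdForm.antidiagonal 3).over K)).dist ⟨stdLattice K 3, 0, isSelfDualLattice_stdLattice_three_of_v hϖ⟩ w = (latticeGraph σ ϖ ((StdForm.antidiagonal 3).over K)).dist ⟨stdLattice K 3, 0, isSelfDualLattice_stdLattice_three_of_v hϖ⟩ c + 1 → (latticeGraph σ ϖ ((StdForm.antidiagonal 3).over K)).Adj c w' → (latticeGraph σ ϖ ((StdForm.antidiagonal 3).over K)).dist ⟨stdLattice K 3, 0, isSelfDualLattice_stdLattice_three_of_v hϖ⟩ w' = (latticeGraph σ ϖ ((StdForm.antidiagonal 3).over K)).dist ⟨stdLattice K 3, 0, isSelfDualLattice_stdLattice_three_of_v hϖ⟩ c + 1 → (P w ↔ P w') := by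
    intro c hvc hdc w w' hcw hdw hcw' hdw'
    obtain ⟨κ, hκ, hcκ⟩ := hnb c hvc
    have hne : w ≠ (latticeGraphIso σ ϖ ((StdForm.antidiagonal 3).over K) u ⟨stdLattice K 3, 0, isSelfDualLattice_stdLattice_three_of_v hϖ⟩) := by intro h; rw [h] at hdw; omega
    have hne' : w' ≠ (latticeGraphIso σ ϖ ((StdForm.antidiagonal 3).over K) u ⟨stdLattice K 3, 0, isSelfDualLattice_stdLattice_three_of_v hϖ⟩) := by intro h; rw [h] at hdw'; omega
    have hw : (latticeGraph σ ϖ ((StdForm.antidiagonal 3).over K)).Adj (latticeGraphIso σ ϖ ((StdForm.antidiagonal 3).over K) (u * κ) ⟨latt (Matrix.diagonal ![(1 : K), 1, ϖ]), 2, isVertexLattice_two_N₁_of_neg hσϖ hϖ⟩) w := by rw [← hcκ]; exact hcw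
    have hw' : (latticeGraph σ ϖ ((StdForm.antidiagonal 3).over K)).Adj (latticeGraphIso σ ϖ ((StdForm.antidiagonal 3).over K) (u * κ) ⟨latt (Matrix.diagonal ![(1 : K), 1, ϖ]), 2, isVertexLattice_two_N₁_of_neg hσϖ hϖ⟩) w' := by rw [← hcκ]; exact hcw'
    exact (hPκ κ hκ w (hfar κ hκ w hw).2 (hfar κ hκ w hw).1 hne hw).trans (hPκ κ hκ w' (hfar κ hκ w' hw').2 (hfar κ hκ w' hw').1 hne' hw').symm
  -- the right-hand sides agree child by child
  have hRHS : ∀ c, (latticeGraph σ ϖ ((StdForm.antidiagonal 3).over K)).Adj (latticeGraphIso σ ϖ ((StdForm.antidiagonal 3).over K) u ⟨stdLattice K 3, 0, isSelfDualLattice_stdLattice_three_of_v hϖ⟩) c → (latticeGraph σ ϖ ((StdForm.antidiagonal 3).over K)).dist ⟨stdLattice K 3, 0, isSelfDualLattice_stdLattice_three_of_v hϖ⟩ c = (latticeGraph σ ϖ ((StdForm.antidiagonal 3).over K)).dist ⟨stdLattice K 3, 0, isSelfDualLattice_stdLattice_three_of_v hϖ⟩ (latticeGraphIso σ ϖ ((StdForm.antidiagonal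 3).over K) u ⟨stdLattice K 3, 0, isSelfDualLattice_stdLattice_three_of_v hϖ⟩) + 1 →
      ((∀ w, (latticeGraph σ ϖ ((StdForm.antidiagonal 3).over K)).Adj c w → (latticeGraph σ ϖ ((StdForm.antidiagonal 3).over K)).dist ⟨stdLattice K 3, 0, isSelfDualLattice_stdLattice_three_of_v hϖ⟩ w = (latticeGraph σ ϖ ((StdForm.antidiagonal 3).over K)).dist ⟨stdLattice K 3, 0, isSelfDualLattice_stdLattice_three_of_v hϖ⟩ c + 1 → P w) ↔ ∃ κ : unitaryGroupOfForm σ ((StdForm.antidiagonal 3).over K), κ ∈ unitaryInt σ ((StdForm.antidiagonal 3).over K) ∧ c = latticeGraphIso σ ϖ ((StdForm.antidiagonal 3).over K) (u * κ) ⟨latt (Matrix.diagonal ![(1 : K), 1, ϖ]), 2, isVertexLattice_two_N₁_of_neg hσϖ hϖ⟩ ∧ Pκ κ) := by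
    intro c hvc hdc
    obtain ⟨κ, hκ, hcκ⟩ := hnb c hvc
    constructor
    · intro hall; exact ⟨κ, hκ, hcκ, (hkey c hvc hdc κ hκ hcκ).1 hall⟩
    · rintro ⟨κ', hκ', hcκ', hPk'⟩; exact (hkey c hvc hdc κ' hκ' hcκ').2 hPk'
  rcases eq_or_ne (latticeGraphIso σ ϖ ((StdForm.antidiagonal 3).over K) u ⟨stdLattice K 3, 0, isSelfDualLattice_stdLattice_three_of_v hϖ⟩) ⟨stdLattice K 3, 0, isSelfDualLattice_stdLattice_three_of_v hϖ⟩ with hvr | hvr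
  · -- ### THE ROOT CASE: ★ ROW-ROOT-SLICE
    have hγ0 : γ ∈ unitaryInt σ ((StdForm.antidiagonal 3).over K) := by
      have h := mem_unitaryInt_conj_of_latticeGraphIso_apply_root_eq (γ := γ) (u := (1 : unitaryGroupOfForm σ ((StdForm.antidiagonal 3).over K)))
        (by rw [latticeGraphIso_one_apply, ← hvr]; exact hfix)
      simpa only [inv_one, one_mul, mul_one] using h
    have hdeep : ∀ i j, Valued.v ((((γ : GL (Fin 3) K) : Matrix (Fin 3) (Fin 3) K) - 1) i j) ≤ Valued.v ϖ ^ 2 := by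
      have e : mapGL ((1 : unitaryGroupOfForm σ ((StdForm.antidiagonal 3).over K)) : GL (Fin 3) K) (stdLattice K 3) = (⟨stdLattice K 3, 0, isSelfDualLattice_stdLattice_three_of_v hϖ⟩ : {M : Submodule 𝒪[K] (Fin 3 → K) // IsVertex σ ϖ ((StdForm.antidiagonal 3).over K) M}).1 := by rw [Subgroup.coe_one, mapGL_one]
      have hlev2' := hlev2
      rw [hvr] at hlev2'
      have h := (forall_v_conj_sub_one_le_iff_map_sub_one_le_scaleLattice γ (1 : unitaryGroupOfForm σ ((StdForm.antidiagonal 3).over K)) (pow_ne_zero 2 hϖ0)).1 (by rw [e]; exact hlev2')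
      intro i j
      have hij := h i j
      simp only [inv_one, one_mul, mul_one, map_pow] at hij
      exact hij
    rw [hvr] at hP hRHS ⊢
    have hPr : ∀ c, (latticeGraph σ ϖ ((StdForm.antidiagonal 3).over K)).Adj ⟨stdLattice K 3, 0, isSelfDualLattice_stdLattice_three_of_v hϖ⟩ c → ∀ w w', (latticeGraph σ ϖ ((StdForm.antidiagonal 3).over K)).Adj c w → (latticeGraph σ ϖ ((StdForm.antidiagonal 3).over K)).dist ⟨stdLattice K 3, 0, isSelfDualLattice_stdLattice_three_of_v hϖ⟩ w = 2 → (latticeGraph σ ϖ ((StdForm.antidiagonal 3).over K)).Adj c w' → (latticeGraph σ ϖ ((StdForm.antidiagonal 3).over K)).dist ⟨stdLattice K 3, 0, isSelfDualLattice_stdLattice_three_of_v hϖ⟩ w' = 2 → (P w ↔ P w') := by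
      intro c hc w w' hcw hdw hcw' hdw'
      have hd1 : (latticeGraph σ ϖ ((StdForm.antidiagonal 3).over K)).dist ⟨stdLattice K 3, 0, isSelfDualLattice_stdLattice_three_of_v hϖ⟩ c = 1 := SimpleGraph.dist_eq_one_iff_adj.2 hc
      exact hP c hc (by rw [hd1, SimpleGraph.dist_self]) w w' hcw (by rw [hdw, hd1]) hcw' (by rw [hdw', hd1])
    have hmain := ncard_rootGrandchildren_sep_eq_mul_ncard_of_congr_sq hσ hvσ hσϖ hϖ hres h2 hT hγ0 hdeep P hPr
    refine Eq.trans ?_ (hmain.trans ?_)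
    · rfl
    · congr 1
      congr 1
      ext c
      simp only [Set.mem_setOf_eq]
      constructor
      · rintro ⟨hc, hall⟩
        have hd1 : (latticeGraph σ ϖ ((StdForm.antidiagonal 3).over K)).dist ⟨stdLattice K 3, 0, isSelfDualLattice_stdLattice_three_of_v hϖ⟩ c = 1 := SimpleGraph.dist_eq_one_iff_adj.2 hc
        have hdc : (latticeGraph σ ϖ ((StdForm.antidiagonal 3).over K)).dist ⟨stdLattice K 3, 0, isSelfDualLattice_stdLattice_three_of_v hϖ⟩ c = (latticeGraph σ ϖ ((StdForm.antidiagonal 3).over K)).dist ⟨stdLattice K 3, 0, isSelfDualLattice_stdLattice_three_of_v hϖ⟩ (⟨stdLattice K 3, 0, isSelfDualLattice_stdLattice_three_of_v hϖ⟩ : {M : Submodule 𝒪[K] (Fin 3 → K) // IsVertex σ ϖ ((StdForm.antidiagonal 3).over K) M}) + 1 := by rw [hd1, SimpleGraph.dist_self]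
        exact ⟨hc, hdc, (hRHS c hc hdc).1 (fun w hw hdw => hall w hw (by rw [hdw, hd1]))⟩
      · rintro ⟨hc, hdc, hex⟩
        have hd1 : (latticeGraph σ ϖ ((StdForm.antidiagonal 3).over K)).dist ⟨stdLattice K 3, 0, isSelfDualLattice_stdLattice_three_of_v hϖ⟩ c = 1 := SimpleGraph.dist_eq_one_iff_adj.2 hc
        exact ⟨hc, fun w hw hdw => (hRHS c hc hdc).2 hex w hw (by rw [hdw, hd1])⟩
  · -- ### THE GENERIC CASE `v ≠ r₀`: ★ J6-mult, every child passes
    have hγϖ : ∀ i j, Valued.v ((((((u)⁻¹ * γ * (u) : unitaryGroupOfForm σ ((StdForm.antidiagonal 3).over K)) : GL (Fin 3) K) : Matrix (Fin 3) (Fin 3) K) - 1) i j) ≤ Valued.v ϖ :=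
      fun i j => (hγϖ2 i j).trans (by rw [sq]; exact mul_le_of_le_one_left zero_le hϖ1.le)
    have hlev := (forall_v_conj_sub_one_le_iff_map_sub_one_le_scaleLattice γ u hϖ0).2 hγϖ
    have hv : IsSelfDualLattice σ ϖ ((StdForm.antidiagonal 3).over K) (latticeGraphIso σ ϖ ((StdForm.antidiagonal 3).over K) u ⟨stdLattice K 3, 0, isSelfDualLattice_stdLattice_three_of_v hϖ⟩).1 := isVertexLattice_mapGL σ ϖ _ _ u.2 (isSelfDualLattice_stdLattice_three_of_v hϖ)
    have hmain := ncard_fixedGrandchildren_sep_eq_mul_ncard_passingChildren hσ hvσ hσϖ hϖ hres h2 hT hv hvr hfix hlev P hP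
    refine Eq.trans ?_ (hmain.trans ?_)
    · rfl
    · congr 1
      congr 1
      ext c
      simp only [Set.mem_setOf_eq]
      constructor
      · rintro ⟨hadj, hdc, -, hall⟩; exact ⟨hadj, hdc, (hRHS c hadj hdc).1 hall⟩
      · rintro ⟨hadj, hdc, hex⟩
        obtain ⟨κ, hκK, hc⟩ := hnb c hadj
        refine ⟨hadj, hdc, fun w hw => ?_, (hRHS c hadj hdc).2 hex⟩
        rw [hc] at hw
        exact forall_fixed_neighbor_of_congr_sq hvσ hσϖ hϖ hres hγK hκK hγϖ2 hw

/-! ## §3 The two v5 socket texts -/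

/-- **ROW-ROOT-SLICE, κ-keyed (skeleton v5 socket `row_rootSlice`)**: at the root with `γ ∈ K₀`, `γ ≡ 1 (ϖ²)`, a vertex predicate `P` decided on each slice by a frame
predicate `Pκ` is counted by `#{w ∈ GC(r₀) : P w} = q · #{c ~ r₀ : ∃ κ ∈ K₀, c = κ·N₁ ∧ Pκ κ}` (§2 at `u = 1`). [cite: Kottwitz1986, §3] [cite: Serre1980Trees, I.2.3, II.1.1]
[cite: BruhatTits1972, §10] -/
theorem ncard_rootGrandchildren_sep_eq_mul_ncard_keyed (hσ : ∀ x, σ (σ x) = x) (hvσ : ∀ a, Valued.v (σ a) = Valued.v a) (hσϖ : σ ϖ = -ϖ)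
    (hϖ : Valued.v ϖ = WithZero.exp (-1 : ℤ)) (hres : ∀ x : K, Valued.v x ≤ 1 → Valued.v (σ x - x) < 1) (h2 : Valued.v (2 : K) = 1) [Finite 𝓀[K]]
    (hT : (latticeGraph σ ϖ ((StdForm.antidiagonal 3).over K)).IsTree)
    {γ : unitaryGroupOfForm σ ((StdForm.antidiagonal 3).over K)} (hγ0 : γ ∈ unitaryInt σ ((StdForm.antidiagonal 3).over K))
    (hdeep : ∀ i j, Valued.v ((((γ : GL (Fin 3) K) : Matrix (Fin 3) (Fin 3) K) - 1) i j) ≤ Valued.v ϖ ^ 2)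
    (Pκ : unitaryGroupOfForm σ ((StdForm.antidiagonal 3).over K) → Prop) (P : {M : Submodule 𝒪[K] (Fin 3 → K) // IsVertex σ ϖ ((StdForm.antidiagonal 3).over K) M} → Prop)
    (hPκ : ∀ κ : unitaryGroupOfForm σ ((StdForm.antidiagonal 3).over K), κ ∈ unitaryInt σ ((StdForm.antidiagonal 3).over K) → ∀ w : {M : Submodule 𝒪[K] (Fin 3 → K) // IsVertex σ ϖ ((StdForm.antidiagonal 3).over K) M}, IsSelfDualLattice σ ϖ ((StdForm.antidiagonal 3).over K) w.1 → latticeGraphIso σ ϖ ((StdForm.antidiagonal 3).over K) γ w = w → w ≠ ⟨stdLattice K 3, 0, isSelfDualLattice_stdLattice_three_of_v hϖ⟩ →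
      (latticeGraph σ ϖ ((StdForm.antidiagonal 3).over K)).Adj (latticeGraphIso σ ϖ ((StdForm.antidiagonal 3).over K) κ ⟨latt (Matrix.diagonal ![(1 : K), 1, ϖ]), 2, isVertexLattice_two_N₁_of_neg hσϖ hϖ⟩) w → (P w ↔ Pκ κ)) :
    ({w | w ∈ {w | ∃ c, ((latticeGraph σ ϖ ((StdForm.antidiagonal 3).over K)).Adj ⟨stdLattice K 3, 0, isSelfDualLattice_stdLattice_three_of_v hϖ⟩ c ∧ (latticeGraph σ ϖ ((StdForm.antidiagonal 3).over K)).dist ⟨stdLattice K 3, 0, isSelfDualLattice_stdLattice_three_of_v hϖ⟩ c = (latticeGraph σ ϖ ((StdForm.antidiagonal 3).over K)).dist ⟨stdLattice K 3, 0, isSelfDualLattice_stdLattice_three_of_v hϖ⟩ ⟨stdLattice K 3, 0, isSelfDualLattice_stdLattice_three_of_v hϖ⟩ + 1 ∧ latticeGraphIso σ ϖ ((StdForm.antidiagonal 3).over K) γ c = c) ∧ ((latticeGraph σ ϖ ((StdForm.antidiagonal 3).over K)).Adj c w ∧ (latticeGraph σ ϖ ((StdForm.antidiagonal 3).over K)).dist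 ⟨stdLattice K 3, 0, isSelfDualLattice_stdLattice_three_of_v hϖ⟩ w = (latticeGraph σ ϖ ((StdForm.antidiagonal 3).over K)).dist ⟨stdLattice K 3, 0, isSelfDualLattice_stdLattice_three_of_v hϖ⟩ c + 1 ∧ latticeGraphIso σ ϖ ((StdForm.antidiagonal 3).over K) γ w = w)} ∧ (P w)}).ncard = Nat.card 𝓀[K] * ({c : {M : Submodule 𝒪[K] (Fin 3 → K) // IsVertex σ ϖ ((StdForm.antidiagonal 3).over K) M} | (latticeGraph σ ϖ ((StdForm.antidiagonal 3).over K)).Adj ⟨stdLattice K 3, 0, isSelfDualLattice_stdLattice_three_of_v hϖ⟩ c ∧ ∃ κ : unitaryGroupOfForm σ ((StdForm.antidiagonal 3).over K), κ ∈ unitaryInt σ ((StdForm.antidiagonal 3).over K) ∧ c = latticeGraphIso σ ϖ ((StdForm.antidiagonal 3).over K) κ ⟨latt (Matrix.diagonal ![(1 : K), 1, ϖ]), 2, isVertexLattice_two_N₁_of_neg hσϖ hϖ⟩ ∧ (Pκ κ)}).ncard := by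
  have hϖ0 : ϖ ≠ 0 := fun h0 => by rw [h0, map_zero] at hϖ; exact WithZero.coe_ne_zero hϖ.symm
  have hr1 : latticeGraphIso σ ϖ ((StdForm.antidiagonal 3).over K) 1 (⟨stdLattice K 3, 0, isSelfDualLattice_stdLattice_three_of_v hϖ⟩ : {M : Submodule 𝒪[K] (Fin 3 → K) // IsVertex σ ϖ ((StdForm.antidiagonal 3).over K) M}) = ⟨stdLattice K 3, 0, isSelfDualLattice_stdLattice_three_of_v hϖ⟩ := latticeGraphIso_one_apply _
  have hfix : latticeGraphIso σ ϖ ((StdForm.antidiagonal 3).over K) γ (latticeGraphIso σ ϖ ((StdForm.antidiagonal 3).over K) 1 ⟨stdLattice K 3, 0, isSelfDualLattice_stdLattice_three_of_v hϖ⟩) = latticeGraphIso σ ϖ ((StdForm.antidiagonal 3).over K) 1 ⟨stdLattice K 3, 0, isSelfDualLattice_stdLattice_three_of_v hϖ⟩ := by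
    rw [hr1]; exact latticeGraphIso_root_eq_of_mem_unitaryInt hϖ hγ0
  have hlev2 : (latticeGraphIso σ ϖ ((StdForm.antidiagonal 3).over K) 1 (⟨stdLattice K 3, 0, isSelfDualLattice_stdLattice_three_of_v hϖ⟩ : {M : Submodule 𝒪[K] (Fin 3 → K) // IsVertex σ ϖ ((StdForm.antidiagonal 3).over K) M})).1.map ((Matrix.toLin' (((γ : GL (Fin 3) K) : Matrix (Fin 3) (Fin 3) K) - 1)).restrictScalars 𝒪[K]) ≤ scaleLattice (ϖ ^ 2) (latticeGraphIso σ ϖ ((StdForm.antidiagonal 3).over K) 1 (⟨stdLattice K 3, 0, isSelfDualLattice_stdLattice_three_of_v hϖ⟩ : {M : Submodule 𝒪[K] (Fin 3 → K) // IsVertex σ ϖ ((StdForm.antidiagonal 3).over K) M})).1 := by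
    refine (forall_v_conj_sub_one_le_iff_map_sub_one_le_scaleLattice γ (1 : unitaryGroupOfForm σ ((StdForm.antidiagonal 3).over K)) (pow_ne_zero 2 hϖ0)).2 ?_
    intro i j
    simp only [inv_one, one_mul, mul_one, map_pow]
    exact hdeep i j
  have hPκ' : ∀ κ : unitaryGroupOfForm σ ((StdForm.antidiagonal 3).over K), κ ∈ unitaryInt σ ((StdForm.antidiagonal 3).over K) → ∀ w : {M : Submodule 𝒪[K] (Fin 3 → K) // IsVertex σ ϖ ((StdForm.antidiagonal 3).over K) M}, IsSelfDualLattice σ ϖ ((StdForm.antidiagonal 3).over K) w.1 → latticeGraphIso σ ϖ ((StdForm.antidiagonal 3).over K) γ w = w → w ≠ latticeGraphIso σ ϖ ((StdForm.antidiagonal 3).over K) 1 ⟨stdLattice K 3, 0, isSelfDualLattice_stdLattice_three_of_v hϖ⟩ →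
      (latticeGraph σ ϖ ((StdForm.antidiagonal 3).over K)).Adj (latticeGraphIso σ ϖ ((StdForm.antidiagonal 3).over K) (1 * κ) ⟨latt (Matrix.diagonal ![(1 : K), 1, ϖ]), 2, isVertexLattice_two_N₁_of_neg hσϖ hϖ⟩) w → (P w ↔ Pκ κ) := fun κ hκ w hsd hfw hne hadj =>
    hPκ κ hκ w hsd hfw (by rw [hr1] at hne; exact hne) (by rw [one_mul] at hadj; exact hadj)
  have hmain := ncard_fixedGrandchildren_sep_eq_mul_ncard_keyed hσ hvσ hσϖ hϖ hres h2 hT 1 hfix hlev2 Pκ P hPκ'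
  rw [hr1] at hmain
  refine Eq.trans ?_ (hmain.trans ?_)
  · rfl
  · congr 1
    congr 1
    ext c
    simp only [Set.mem_setOf_eq, one_mul]
    constructor
    · rintro ⟨hc, -, hex⟩
      exact ⟨hc, hex⟩
    · rintro ⟨hc, hex⟩
      exact ⟨hc, by rw [SimpleGraph.dist_self, SimpleGraph.dist_eq_one_iff_adj.2 hc], hex⟩

/-- **S3 OFF-REGION SLICE COUNT, κ-keyed (skeleton v5 socket `row_offRegionSlice`)**: at a region vertex `v = u·r₀` (`γ·v = v`, `LEV[v](ϖ^{d₀})`, `d₀ ≥ 3`) a vertex predicate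
`P` decided on each slice by a frame predicate `Pκ` of the child `(uκ)·N₁` is counted by `#{w ∈ GC(v) : P w} = q · #{children : ∃ κ ∈ K₀, c = (uκ)·N₁ ∧ Pκ κ}` (§2; the isoceles
eigen-data are carried, not used). [cite: Kottwitz1986, §3] [cite: Serre1980Trees, I.2.3, II.1.1] [cite: BruhatTits1972, §10] [cite: Tits1979, §3.5] -/
theorem ncard_offRegionGrandchildren_sep_eq_mul_ncard_keyed (hσ : ∀ x, σ (σ x) = x) (hvσ : ∀ a, Valued.v (σ a) = Valued.v a) (hσϖ : σ ϖ = -ϖ)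
    (hϖ : Valued.v ϖ = WithZero.exp (-1 : ℤ)) (hres : ∀ x : K, Valued.v x ≤ 1 → Valued.v (σ x - x) < 1) (h2 : Valued.v (2 : K) = 1) [Finite 𝓀[K]]
    (hT : (latticeGraph σ ϖ ((StdForm.antidiagonal 3).over K)).IsTree)
    {γ : unitaryGroupOfForm σ ((StdForm.antidiagonal 3).over K)} (_hγ0 : γ ∈ unitaryInt σ ((StdForm.antidiagonal 3).over K))
    (d : Fin 3 → K) (_hd : ∀ i, Valued.v (d i) = 1) (_hdσ : ∀ i, σ (d i) = d i)
    (A : GL (Fin 3) K) (_hA : IsIntMatrix (A : Matrix (Fin 3) (Fin 3) K)) (_hA' : IsIntMatrix ((A⁻¹ : GL (Fin 3) K) : Matrix (Fin 3) (Fin 3) K))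
    (_hdA : Matrix.diagonal d = (-(Matrix.diagonal d).det) • formCongr σ A ((StdForm.antidiagonal 3).over K))
    (s : Fin 3 → K) (_hs1 : s 1 = 1) (_hsv : ∀ i, Valued.v (s i) = 1) (_hsσ : ∀ i, s i * σ (s i) = 1)
    (_hγA : ((γ : GL (Fin 3) K) : Matrix (Fin 3) (Fin 3) K) = (A : Matrix (Fin 3) (Fin 3) K) * Matrix.diagonal s * ((A⁻¹ : GL (Fin 3) K) : Matrix (Fin 3) (Fin 3) K))
    (i₀ : Fin 3) {d₀ : ℕ} (hd3 : 3 ≤ d₀) (_he : ∀ i, Valued.v (s i - 1) ≤ Valued.v ϖ ^ d₀)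
    (_hiso : ∀ j, j ≠ i₀ → Valued.v (s i₀ - s j) = Valued.v ϖ ^ d₀) (_hclose : ∀ j k, j ≠ i₀ → k ≠ i₀ → Valued.v (s j - s k) ≤ Valued.v ϖ ^ (d₀ + 2))
    (u : unitaryGroupOfForm σ ((StdForm.antidiagonal 3).over K)) {v : {M : Submodule 𝒪[K] (Fin 3 → K) // IsVertex σ ϖ ((StdForm.antidiagonal 3).over K) M}} (hvu : v = latticeGraphIso σ ϖ ((StdForm.antidiagonal 3).over K) u ⟨stdLattice K 3, 0, isSelfDualLattice_stdLattice_three_of_v hϖ⟩)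
    (_hv : IsSelfDualLattice σ ϖ ((StdForm.antidiagonal 3).over K) v.1) (hfix : latticeGraphIso σ ϖ ((StdForm.antidiagonal 3).over K) γ v = v) (hvR : v.1.map ((Matrix.toLin' (((γ : GL (Fin 3) K) : Matrix (Fin 3) (Fin 3) K) - 1)).restrictScalars 𝒪[K]) ≤ scaleLattice (ϖ ^ d₀) v.1)
    (Pκ : unitaryGroupOfForm σ ((StdForm.antidiagonal 3).over K) → Prop) (P : {M : Submodule 𝒪[K] (Fin 3 → K) // IsVertex σ ϖ ((StdForm.antidiagonal 3).over K) M} → Prop)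
    (hPκ : ∀ κ : unitaryGroupOfForm σ ((StdForm.antidiagonal 3).over K), κ ∈ unitaryInt σ ((StdForm.antidiagonal 3).over K) → ∀ w : {M : Submodule 𝒪[K] (Fin 3 → K) // IsVertex σ ϖ ((StdForm.antidiagonal 3).over K) M}, IsSelfDualLattice σ ϖ ((StdForm.antidiagonal 3).over K) w.1 → latticeGraphIso σ ϖ ((StdForm.antidiagonal 3).over K) γ w = w → w ≠ v →
      (latticeGraph σ ϖ ((StdForm.antidiagonal 3).over K)).Adj (latticeGraphIso σ ϖ ((StdForm.antidiagonal 3).over K) (u * κ) ⟨latt (Matrix.diagonal ![(1 : K), 1, ϖ]), 2, isVertexLattice_two_N₁_of_neg hσϖ hϖ⟩) w → (P w ↔ Pκ κ)) :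
    ({w | w ∈ {w | ∃ c, ((latticeGraph σ ϖ ((StdForm.antidiagonal 3).over K)).Adj v c ∧ (latticeGraph σ ϖ ((StdForm.antidiagonal 3).over K)).dist ⟨stdLattice K 3, 0, isSelfDualLattice_stdLattice_three_of_v hϖ⟩ c = (latticeGraph σ ϖ ((StdForm.antidiagonal 3).over K)).dist ⟨stdLattice K 3, 0, isSelfDualLattice_stdLattice_three_of_v hϖ⟩ v + 1 ∧ latticeGraphIso σ ϖ ((StdForm.antidiagonal 3).over K) γ c = c) ∧ ((latticeGraph σ ϖ ((StdForm.antidiagonal 3).over K)).Adj c w ∧ (latticeGraph σ ϖ ((StdForm.antidiagonal 3).over K)).dist ⟨stdLattice K 3, 0, isSelfDualLattice_stdLattice_three_of_v hϖ⟩ w = (latticeGraph σ ϖ ((StdForm.antidiagonal 3).over K)).dist ⟨stdLattice K 3, 0, isSelfDualLattice_stdLattice_three_of_v hϖ⟩ c + 1 ∧ latticeGraphIso σ ϖ ((StdForm.antidiagonal 3).over K) γ w = w)} ∧ (P w)}).ncard =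
      Nat.card 𝓀[K] * {c : {M : Submodule 𝒪[K] (Fin 3 → K) // IsVertex σ ϖ ((StdForm.antidiagonal 3).over K) M} | (latticeGraph σ ϖ ((StdForm.antidiagonal 3).over K)).Adj v c ∧ (latticeGraph σ ϖ ((StdForm.antidiagonal 3).over K)).dist ⟨stdLattice K 3, 0, isSelfDualLattice_stdLattice_three_of_v hϖ⟩ c = (latticeGraph σ ϖ ((StdForm.antidiagonal 3).over K)).dist ⟨stdLattice K 3, 0, isSelfDualLattice_stdLattice_three_of_v hϖ⟩ v + 1 ∧ ∃ κ : unitaryGroupOfForm σ ((StdForm.antidiagonal 3).over K), κ ∈ unitaryInt σ ((StdForm.antidiagonal 3).over K) ∧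
        c = latticeGraphIso σ ϖ ((StdForm.antidiagonal 3).over K) (u * κ) ⟨latt (Matrix.diagonal ![(1 : K), 1, ϖ]), 2, isVertexLattice_two_N₁_of_neg hσϖ hϖ⟩ ∧ Pκ κ}.ncard := by
  have hϖ0 : ϖ ≠ 0 := fun h0 => by rw [h0, map_zero] at hϖ; exact WithZero.coe_ne_zero hϖ.symm
  have hϖ1 : Valued.v ϖ < 1 := by rw [hϖ, ← WithZero.exp_zero]; exact WithZero.exp_lt_exp.2 (by norm_num)
  subst hvu
  have hlev2 : (latticeGraphIso σ ϖ ((StdForm.antidiagonal 3).over K) u ⟨stdLattice K 3, 0, isSelfDualLattice_stdLattice_three_of_v hϖ⟩).1.map ((Matrix.toLin' (((γ : GL (Fin 3) K) : Matrix (Fin 3) (Fin 3) K) - 1)).restrictScalars 𝒪[K]) ≤ scaleLattice (ϖ ^ 2) (latticeGraphIso σ ϖ ((StdForm.antidiagonal 3).over K) u ⟨stdLattice K 3, 0, isSelfDualLattice_stdLattice_three_of_v hϖ⟩).1 := by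
    have h := (forall_v_conj_sub_one_le_iff_map_sub_one_le_scaleLattice γ u (pow_ne_zero d₀ hϖ0)).1 hvR
    refine (forall_v_conj_sub_one_le_iff_map_sub_one_le_scaleLattice γ u (pow_ne_zero 2 hϖ0)).2 fun i j => ?_
    rw [map_pow]
    exact ((map_pow (Valued.v) ϖ d₀) ▸ h i j).trans (pow_le_pow_right_of_le_one' hϖ1.le (by omega))
  exact ncard_fixedGrandchildren_sep_eq_mul_ncard_keyed hσ hvσ hσϖ hϖ hres h2 hT u hfix hlev2 Pκ P hPκ

end Three

end Literature.NumberTheory.Automorphic.UnitaryLatticeTree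

end
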